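import Mathlib
import Summits.ResolutionOfSingularities.ResolutionOfSingularities.Theorems.WildQuotientsWildQuotientResolutionJordanFourChartWDefs

/-!
# V4U T2(a): the membership table of `H′², x_aH′, MH′, x_aM, M² ∈ I₆` and `T′², T′H′³, Δ₇ ∈ I₆²` with explicit cofactors

(crux stmt-ResolutionOfSingularities-15640 `WildQuotients.WildQuotientResolution`, line `Sketch`,
sector `|G| = p`; programme V4U of `L/w45c/CHAIN.md` v7.4, package T2(a) — res-L1-w45c-plan-1 ORDER
(O-a) 2026-08-27T06:24:56Z to stub-4: «the full V6.1 table … over lead-1's literal `I₆` and stub-1's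
`hPrime/tPrime/mSlice/delta7` (p499121), in namespace `JordanFour.I6Table`; `tPrime_mem_I6` /
`hPrime_cube_mem_I6_sq` IMPORTED from p504103, not restated». Cofactor tables = plan-1
`L/w45c/W45cPlanSignaturesV6.lean` V6.1 §T2-support (`mem1_*` / `mem2_*`, greedy monomial division,
kernel-checked there over an arbitrary commutative ring). [OURS · L1 W4.5c] — NOT a statement of any
manuscript; replaces the role of no printed item. Prover res-L1-w45c-stub-4.)

`I₆ = (g₀,…,g₇) = (x_a², x_a x_b², x_a x_b x_c, x_a x_c³, x_b³, x_b² x_c², x_b x_c⁴, x_c⁶)` (lead-1's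
literal `Fin 8` vector of p501160 / stub-5's p504103), `H′ = hPrime`, `T′ = tPrime`, `M = mSlice`,
`Δ₇ = delta7` (stub-1, p499121). For each row: an EQUATION lemma `…_eq` (the explicit cofactor
expansion on the `gⱼ` resp. on the products `gᵢ gⱼ` — what the inverse dictionary of T2(b)
`exists_chartT_ringEquiv` consumes in the chart ring `Γ(D₊(T′t))`) and the MEMBERSHIP lemma.
`T′ ∈ I₆` and `H′³ ∈ I₆²` are `JordanFour.tPrime_mem_I6` / `JordanFour.hPrime_cube_mem_I6_sq`
(p504103) and are only re-used here (`mem2_TH3'`: `T′H′³ ∈ I₆³`).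
-/

-- single-problem summit: the doubled namespace component `ResolutionOfSingularities` is forced
set_option linter.dupNamespace false

noncomputable section

open MvPolynomial

namespace Summit.ResolutionOfSingularities.ResolutionOfSingularities.Theorems.WildQuotientResolution.JordanFour.I6Table

variable (k : Type) [Field k] (n : ℕ) (a b c d : Fin n)

/-! ## Generic: membership from an explicit cofactor expansion -/

/-- `x = ∑ cᵢ gᵢ ⇒ x ∈ (g)`. [folklore] -/
theorem mem_span_range_of_eq_sum {R : Type*} [CommRing R] {m : ℕ} (g : Fin m → R) (x : R)
    (c : Fin m → R) (h : x = ∑ i, c i * g i) : x ∈ Ideal.span (Set.range g) := by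
  rw [h]
  exact Ideal.sum_mem _ fun i _ => Ideal.mul_mem_left _ _ (Ideal.subset_span ⟨i, rfl⟩)

/-- `x = ∑ₜ cₜ · g_{iₜ} g_{jₜ} ⇒ x ∈ (g)²`. [folklore] -/
theorem mem_span_range_sq_of_eq_sum {R : Type*} [CommRing R] {m N : ℕ} (g : Fin m → R) (x : R)
    (c : Fin N → R) (ij : Fin N → Fin m × Fin m)
    (h : x = ∑ t, c t * (g (ij t).1 * g (ij t).2)) : x ∈ Ideal.span (Set.range g) ^ 2 := by
  rw [h]
  refine Ideal.sum_mem _ fun t _ => Ideal.mul_mem_left _ _ ?_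
  rw [pow_two]
  exact Ideal.mul_mem_mul (Ideal.subset_span ⟨(ij t).1, rfl⟩) (Ideal.subset_span ⟨(ij t).2, rfl⟩)

/-! ## The generators evaluate -/

/-- The `Fin 8` vector of generators of `I₆` evaluates as listed. [folklore] -/
theorem I6_apply (j : Fin 8) :
    (![X a ^ 2, X a * X b ^ 2, X a * X b * X c, X a * X c ^ 3, X b ^ 3, X b ^ 2 * X c ^ 2,
        X b * X c ^ 4, X c ^ 6] : Fin 8 → MvPolynomial (Fin n) k) j =
      match j with
      | 0 => X a ^ 2 | 1 => X a * X b ^ 2 | 2 => X a * X b * X c | 3 => X a * X c ^ 3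
      | 4 => X b ^ 3 | 5 => X b ^ 2 * X c ^ 2 | 6 => X b * X c ^ 4 | 7 => X c ^ 6 := by
  fin_cases j <;> rfl

/-! ## Degree one: `H′², x_a H′, M H′, x_a M, M² ∈ I₆` -/

/-- `H′² = (x_b² + 4x_bx_c + 4x_c²)·g₀ + (−2x_b − 4x_c)·g₁ + x_b·g₄`. [OURS · L1 W4.5c] -/
theorem mem1_Hsq_eq :
    hPrime k n a b c ^ 2 =
      (X b ^ 2 + 4 * X b * X c + 4 * X c ^ 2) * (X a ^ 2)
      + (-2 * X b - 4 * X c) * (X a * X b ^ 2)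
      + (X b) * (X b ^ 3) := by
  simp only [hPrime]; ring

/-- **`H′² ∈ I₆`.** [OURS · L1 W4.5c] -/
theorem mem1_Hsq :
    hPrime k n a b c ^ 2 ∈ Ideal.span (Set.range
      (![X a ^ 2, X a * X b ^ 2, X a * X b * X c, X a * X c ^ 3, X b ^ 3, X b ^ 2 * X c ^ 2,
        X b * X c ^ 4, X c ^ 6] : Fin 8 → MvPolynomial (Fin n) k)) :=
  mem_span_range_of_eq_sum _ _
    ![X b ^ 2 + 4 * X b * X c + 4 * X c ^ 2, -2 * X b - 4 * X c, 0, 0, X b, 0, 0, 0]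
    (by simp only [hPrime, Fin.sum_univ_eight]; simp; ring)

/-- `x_a H′ = (−x_b − 2x_c)·g₀ + g₁`. [OURS · L1 W4.5c] -/
theorem mem1_xaH_eq :
    X a * hPrime k n a b c = (-(X b) - 2 * X c) * (X a ^ 2) + (1) * (X a * X b ^ 2) := by
  simp only [hPrime]; ring

/-- **`x_a H′ ∈ I₆`.** [OURS · L1 W4.5c] -/
theorem mem1_xaH :
    X a * hPrime k n a b c ∈ Ideal.span (Set.range
      (![X a ^ 2, X a * X b ^ 2, X a * X b * X c, X a * X c ^ 3, X b ^ 3, X b ^ 2 * X c ^ 2,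
        X b * X c ^ 4, X c ^ 6] : Fin 8 → MvPolynomial (Fin n) k)) :=
  mem_span_range_of_eq_sum _ _ ![-(X b) - 2 * X c, 1, 0, 0, 0, 0, 0, 0]
    (by simp only [hPrime, Fin.sum_univ_eight]; simp; ring)

/-- `M H′ = (−x_b² − 2x_bx_c + 3x_bx_d + 6x_cx_d)·g₀ + (2x_b + x_c − 3x_d)·g₁ + (−2x_c)·g₂ + (−x_b + x_c)·g₄`.
[OURS · L1 W4.5c] -/
theorem mem1_MH_eq :
    mSlice k n a b c d * hPrime k n a b c =
      (-(X b ^ 2) - 2 * X b * X c + 3 * X b * X d + 6 * X c * X d) * (X a ^ 2)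
      + (2 * X b + X c - 3 * X d) * (X a * X b ^ 2)
      + (-2 * X c) * (X a * X b * X c)
      + (-(X b) + X c) * (X b ^ 3) := by
  simp only [mSlice, hPrime]; ring

/-- **`M H′ ∈ I₆`.** [OURS · L1 W4.5c] -/
theorem mem1_MH :
    mSlice k n a b c d * hPrime k n a b c ∈ Ideal.span (Set.range
      (![X a ^ 2, X a * X b ^ 2, X a * X b * X c, X a * X c ^ 3, X b ^ 3, X b ^ 2 * X c ^ 2,
        X b * X c ^ 4, X c ^ 6] : Fin 8 → MvPolynomial (Fin n) k)) :=
  mem_span_range_of_eq_sum _ _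
    ![-(X b ^ 2) - 2 * X b * X c + 3 * X b * X d + 6 * X c * X d, 2 * X b + X c - 3 * X d,
      -2 * X c, 0, -(X b) + X c, 0, 0, 0]
    (by simp only [mSlice, hPrime, Fin.sum_univ_eight]; simp; ring)

/-- `x_a M = (x_b − 3x_d)·g₀ − g₁ + g₂`. [OURS · L1 W4.5c] -/
theorem mem1_xaM_eq :
    X a * mSlice k n a b c d =
      (X b - 3 * X d) * (X a ^ 2) + (-1) * (X a * X b ^ 2) + (1) * (X a * X b * X c) := by
  simp only [mSlice]; ring

/-- **`x_a M ∈ I₆`.** [OURS · L1 W4.5c] -/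
theorem mem1_xaM :
    X a * mSlice k n a b c d ∈ Ideal.span (Set.range
      (![X a ^ 2, X a * X b ^ 2, X a * X b * X c, X a * X c ^ 3, X b ^ 3, X b ^ 2 * X c ^ 2,
        X b * X c ^ 4, X c ^ 6] : Fin 8 → MvPolynomial (Fin n) k)) :=
  mem_span_range_of_eq_sum _ _ ![X b - 3 * X d, -1, 1, 0, 0, 0, 0, 0]
    (by simp only [mSlice, Fin.sum_univ_eight]; simp; ring)

/-- `M² = (x_b² − 6x_bx_d + 9x_d²)·g₀ + (−2x_b + 2x_c + 6x_d)·g₁ + (−6x_d)·g₂ + (x_b − 2x_c)·g₄ + g₅`.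
[OURS · L1 W4.5c] -/
theorem mem1_Msq_eq :
    mSlice k n a b c d ^ 2 =
      (X b ^ 2 - 6 * X b * X d + 9 * X d ^ 2) * (X a ^ 2)
      + (-2 * X b + 2 * X c + 6 * X d) * (X a * X b ^ 2)
      + (-6 * X d) * (X a * X b * X c)
      + (X b - 2 * X c) * (X b ^ 3)
      + (1) * (X b ^ 2 * X c ^ 2) := by
  simp only [mSlice]; ring

/-- **`M² ∈ I₆`.** [OURS · L1 W4.5c] -/
theorem mem1_Msq :
    mSlice k n a b c d ^ 2 ∈ Ideal.span (Set.range
      (![X a ^ 2, X a * X b ^ 2, X a * X b * X c, X a * X c ^ 3, X b ^ 3, X b ^ 2 * X c ^ 2,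
        X b * X c ^ 4, X c ^ 6] : Fin 8 → MvPolynomial (Fin n) k)) :=
  mem_span_range_of_eq_sum _ _
    ![X b ^ 2 - 6 * X b * X d + 9 * X d ^ 2, -2 * X b + 2 * X c + 6 * X d, -6 * X d, 0,
      X b - 2 * X c, 1, 0, 0]
    (by simp only [mSlice, Fin.sum_univ_eight]; simp; ring)

/-- `T′ = (−x_b + 3x_d)·g₀ − 3·g₂ + g₄` (the cofactor row of `JordanFour.tPrime_mem_I6`, p504103).
[OURS · L1 W4.5c] -/
theorem mem1_Tprime_eq :
    tPrime k n a b c d =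
      (-(X b) + 3 * X d) * (X a ^ 2) + (-3) * (X a * X b * X c) + (1) * (X b ^ 3) := by
  simp only [tPrime]; ring

/-! ## Degree two: `T′², Δ₇ ∈ I₆²`, `T′H′³ ∈ I₆³` -/

/-- `T′²` on the products `gᵢgⱼ` (7 cofactors). [OURS · L1 W4.5c] -/
theorem mem2_Tsq_eq :
    tPrime k n a b c d ^ 2 =
      (X b ^ 2 - 6 * X b * X d + 9 * X d ^ 2) * ((X a ^ 2) * (X a ^ 2))
      + (6 * X c) * ((X a ^ 2) * (X a * X b ^ 2))
      + (-18 * X d) * ((X a ^ 2) * (X a * X b * X c))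
      + (-2 * X b + 6 * X d) * ((X a ^ 2) * (X b ^ 3))
      + (9) * ((X a ^ 2) * (X b ^ 2 * X c ^ 2))
      + (-6) * ((X a * X b * X c) * (X b ^ 3))
      + (1) * ((X b ^ 3) * (X b ^ 3)) := by
  simp only [tPrime]; ring

/-- **`T′² ∈ I₆²`.** [OURS · L1 W4.5c] -/
theorem mem2_Tsq :
    tPrime k n a b c d ^ 2 ∈ Ideal.span (Set.range
      (![X a ^ 2, X a * X b ^ 2, X a * X b * X c, X a * X c ^ 3, X b ^ 3, X b ^ 2 * X c ^ 2,
        X b * X c ^ 4, X c ^ 6] : Fin 8 → MvPolynomial (Fin n) k)) ^ 2 :=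
  mem_span_range_sq_of_eq_sum _ _
    ![X b ^ 2 - 6 * X b * X d + 9 * X d ^ 2, 6 * X c, -18 * X d, -2 * X b + 6 * X d, 9, -6, 1]
    ![(0, 0), (0, 1), (0, 2), (0, 4), (0, 5), (2, 4), (4, 4)]
    (by simp only [tPrime, Fin.sum_univ_seven]; simp; ring)

/-- `Δ₇` on the products `gᵢgⱼ` — the identity over an ARBITRARY commutative ring (13 cofactors;
plan-1 V6.1 `mem2_Delta7` verbatim, on stub-1's `delta7Poly`). [OURS · L1 W4.5c] -/
theorem delta7Poly_eq_sum {R : Type*} [CommRing R] (xa xb xc xd : R) :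
    delta7Poly xa xb xc xd =
      (-2 * xb ^ 3 - 6 * xb ^ 2 * xc + 9 * xb ^ 2 * xd + 36 * xb * xc * xd - 54 * xc * xd ^ 2
          - 27 * xd ^ 3) * ((xa ^ 2) * (xa ^ 2))
      + (4 * xb ^ 2 - 3 * xb * xc - 21 * xb * xd - 24 * xc ^ 2 - 18 * xc * xd + 27 * xd ^ 2)
          * ((xa ^ 2) * (xa * xb ^ 2))
      + (8 * xc ^ 2 + 72 * xc * xd + 81 * xd ^ 2) * ((xa ^ 2) * (xa * xb * xc))
      + (-24 * xd) * ((xa ^ 2) * (xa * xc ^ 3))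
      + (21 * xb * xc + 9 * xb * xd + 6 * xc ^ 2 - 54 * xc * xd - 27 * xd ^ 2) * ((xa ^ 2) * (xb ^ 3))
      + (-18 * xc - 45 * xd) * ((xa ^ 2) * (xb ^ 2 * xc ^ 2))
      + (24) * ((xa ^ 2) * (xb * xc ^ 4))
      + (-4 * xb - 9 * xc + 9 * xd) * ((xa * xb ^ 2) * (xb ^ 3))
      + (15) * ((xa * xb ^ 2) * (xb ^ 2 * xc ^ 2))
      + (36 * xd) * ((xa * xb * xc) * (xb ^ 3))
      + (-17) * ((xa * xb * xc) * (xb ^ 2 * xc ^ 2))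
      + (2 * xb - 3 * xc - 6 * xd) * ((xb ^ 3) * (xb ^ 3))
      + (3) * ((xb ^ 3) * (xb ^ 2 * xc ^ 2)) := by
  unfold delta7Poly; ring

/-- **`Δ₇ ∈ I₆²`** (`delta7 = delta7Poly (X a) (X b) (X c) (X d)` by definition; the expansion is
`delta7Poly_eq_sum (X a) (X b) (X c) (X d)`). [OURS · L1 W4.5c] -/
theorem mem2_Delta7 :
    delta7 k n a b c d ∈ Ideal.span (Set.range
      (![X a ^ 2, X a * X b ^ 2, X a * X b * X c, X a * X c ^ 3, X b ^ 3, X b ^ 2 * X c ^ 2,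
        X b * X c ^ 4, X c ^ 6] : Fin 8 → MvPolynomial (Fin n) k)) ^ 2 := by
  have hg : ∀ j : Fin 8, ((![X a ^ 2, X a * X b ^ 2, X a * X b * X c, X a * X c ^ 3, X b ^ 3,
      X b ^ 2 * X c ^ 2, X b * X c ^ 4, X c ^ 6] : Fin 8 → MvPolynomial (Fin n) k) j) ∈
      Ideal.span (Set.range (![X a ^ 2, X a * X b ^ 2, X a * X b * X c, X a * X c ^ 3, X b ^ 3,
        X b ^ 2 * X c ^ 2, X b * X c ^ 4, X c ^ 6] : Fin 8 → MvPolynomial (Fin n) k)) :=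
    fun j => Ideal.subset_span ⟨j, rfl⟩
  have hmul : ∀ i j : Fin 8, (![X a ^ 2, X a * X b ^ 2, X a * X b * X c, X a * X c ^ 3, X b ^ 3,
      X b ^ 2 * X c ^ 2, X b * X c ^ 4, X c ^ 6] : Fin 8 → MvPolynomial (Fin n) k) i *
      (![X a ^ 2, X a * X b ^ 2, X a * X b * X c, X a * X c ^ 3, X b ^ 3,
      X b ^ 2 * X c ^ 2, X b * X c ^ 4, X c ^ 6] : Fin 8 → MvPolynomial (Fin n) k) j ∈
      Ideal.span (Set.range (![X a ^ 2, X a * X b ^ 2, X a * X b * X c, X a * X c ^ 3, X b ^ 3,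
        X b ^ 2 * X c ^ 2, X b * X c ^ 4, X c ^ 6] : Fin 8 → MvPolynomial (Fin n) k)) ^ 2 :=
    fun i j => by rw [pow_two]; exact Ideal.mul_mem_mul (hg i) (hg j)
  rw [show delta7 k n a b c d = delta7Poly (X a) (X b) (X c) (X d) from rfl, delta7Poly_eq_sum]
  refine Ideal.add_mem _ (Ideal.add_mem _ (Ideal.add_mem _ (Ideal.add_mem _ (Ideal.add_mem _
    (Ideal.add_mem _ (Ideal.add_mem _ (Ideal.add_mem _ (Ideal.add_mem _ (Ideal.add_mem _
    (Ideal.add_mem _ (Ideal.add_mem _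
    (Ideal.mul_mem_left _ _ (hmul 0 0)) (Ideal.mul_mem_left _ _ (hmul 0 1)))
    (Ideal.mul_mem_left _ _ (hmul 0 2))) (Ideal.mul_mem_left _ _ (hmul 0 3)))
    (Ideal.mul_mem_left _ _ (hmul 0 4))) (Ideal.mul_mem_left _ _ (hmul 0 5)))
    (Ideal.mul_mem_left _ _ (hmul 0 6))) (Ideal.mul_mem_left _ _ (hmul 1 4)))
    (Ideal.mul_mem_left _ _ (hmul 1 5))) (Ideal.mul_mem_left _ _ (hmul 2 4)))
    (Ideal.mul_mem_left _ _ (hmul 2 5))) (Ideal.mul_mem_left _ _ (hmul 4 4))) ?_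
  exact Ideal.mul_mem_left _ _ (hmul 4 5)

set_option maxHeartbeats 400000 in
/-- `T′H′³` on the products `gᵢgⱼ` (5 cofactors; plan-1 V6.1 `mem2_TH3`, as stated there: `∈ I₆²`).
[OURS · L1 W4.5c] -/
theorem mem2_TH3_eq :
    tPrime k n a b c d * hPrime k n a b c ^ 3 =
      (X a * X b ^ 4 + 6 * X a * X b ^ 3 * X c - 3 * X a * X b ^ 3 * X d + 12 * X a * X b ^ 2 * X c ^ 2
          - 18 * X a * X b ^ 2 * X c * X d + 8 * X a * X b * X c ^ 3 - 36 * X a * X b * X c ^ 2 * X d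
          - 24 * X a * X c ^ 3 * X d - 3 * X b ^ 5 - 9 * X b ^ 4 * X c + 9 * X b ^ 4 * X d
          + 6 * X b ^ 3 * X c ^ 2 + 36 * X b ^ 3 * X c * X d + 36 * X b ^ 2 * X c ^ 3
          + 36 * X b ^ 2 * X c ^ 2 * X d + 24 * X b * X c ^ 4) * ((X a ^ 2) * (X a ^ 2))
      + (2 * X b ^ 4 - 9 * X b ^ 3 * X c - 9 * X b ^ 3 * X d - 48 * X b ^ 2 * X c ^ 2
          - 18 * X b ^ 2 * X c * X d - 44 * X b * X c ^ 3) * ((X a ^ 2) * (X a * X b ^ 2))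
      + (2 * X b ^ 4 + 21 * X b ^ 3 * X c + 3 * X b ^ 3 * X d + 30 * X b ^ 2 * X c ^ 2)
          * ((X a ^ 2) * (X b ^ 3))
      + (-3 * X b ^ 3 - 9 * X b ^ 2 * X c) * ((X a * X b ^ 2) * (X b ^ 3))
      + (X b ^ 3) * ((X b ^ 3) * (X b ^ 3)) := by
  simp only [tPrime, hPrime]; ring

/-- **`T′H′³ ∈ I₆²`** (as the V6.1 table states it). [OURS · L1 W4.5c] -/
theorem mem2_TH3 :
    tPrime k n a b c d * hPrime k n a b c ^ 3 ∈ Ideal.span (Set.range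
      (![X a ^ 2, X a * X b ^ 2, X a * X b * X c, X a * X c ^ 3, X b ^ 3, X b ^ 2 * X c ^ 2,
        X b * X c ^ 4, X c ^ 6] : Fin 8 → MvPolynomial (Fin n) k)) ^ 2 :=
  mem_span_range_sq_of_eq_sum _ _
    ![X a * X b ^ 4 + 6 * X a * X b ^ 3 * X c - 3 * X a * X b ^ 3 * X d + 12 * X a * X b ^ 2 * X c ^ 2
          - 18 * X a * X b ^ 2 * X c * X d + 8 * X a * X b * X c ^ 3 - 36 * X a * X b * X c ^ 2 * X d
          - 24 * X a * X c ^ 3 * X d - 3 * X b ^ 5 - 9 * X b ^ 4 * X c + 9 * X b ^ 4 * X d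
          + 6 * X b ^ 3 * X c ^ 2 + 36 * X b ^ 3 * X c * X d + 36 * X b ^ 2 * X c ^ 3
          + 36 * X b ^ 2 * X c ^ 2 * X d + 24 * X b * X c ^ 4,
      2 * X b ^ 4 - 9 * X b ^ 3 * X c - 9 * X b ^ 3 * X d - 48 * X b ^ 2 * X c ^ 2
          - 18 * X b ^ 2 * X c * X d - 44 * X b * X c ^ 3,
      2 * X b ^ 4 + 21 * X b ^ 3 * X c + 3 * X b ^ 3 * X d + 30 * X b ^ 2 * X c ^ 2,
      -3 * X b ^ 3 - 9 * X b ^ 2 * X c,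
      X b ^ 3]
    ![(0, 0), (0, 1), (0, 4), (1, 4), (4, 4)]
    (by simp only [tPrime, hPrime, Fin.sum_univ_five]; simp; ring)

/-- **`T′H′³ ∈ I₆³`** (the structural bound: `T′ ∈ I₆`, `H′³ ∈ I₆²`, p504103). [OURS · L1 W4.5c] -/
theorem mem3_TH3 :
    tPrime k n a b c d * hPrime k n a b c ^ 3 ∈ Ideal.span (Set.range
      (![X a ^ 2, X a * X b ^ 2, X a * X b * X c, X a * X c ^ 3, X b ^ 3, X b ^ 2 * X c ^ 2,
        X b * X c ^ 4, X c ^ 6] : Fin 8 → MvPolynomial (Fin n) k)) ^ 3 := by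
  rw [pow_succ']
  exact Ideal.mul_mem_mul (tPrime_mem_I6 k n a b c d) (hPrime_cube_mem_I6_sq k n a b c)

/-! ## The structural relations between the invariants (for the inverse dictionary) -/

/-- `x_a² Δ₇ = T′H′³ − T′³ + 3 x_a T′² H′` (stub-1 `X_a_sq_mul_delta7`, p499121, re-exported in the
table's namespace for convenience of citation; NOT restated — a direct term). [OURS · L1 W4.5c] -/
theorem xa_sq_mul_Delta7 :
    X a ^ 2 * delta7 k n a b c d =
      tPrime k n a b c d * hPrime k n a b c ^ 3 - tPrime k n a b c d ^ 3 +
        3 * X a * tPrime k n a b c d ^ 2 * hPrime k n a b c :=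
  X_a_sq_mul_delta7 k n a b c d

end Summit.ResolutionOfSingularities.ResolutionOfSingularities.Theorems.WildQuotientResolution.JordanFour.I6Table

end
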